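import Summits.BirchSwinnertonDyer.BirchSwinnertonDyer.Theorems.ClassRecordThreeCornerAtThreeKolyImageOrderBoundShift
import Literature.NumberTheory.EllipticCurves.HeegnerPointsKolyvaginPrimaryOrderDivisibleProofs
import HarnessLib
/-!
# The IMAGE-KEYED Kolyvagin ORDER machine WITH GLOBAL DIVISIBILITY (D1 of the «SHIFT×DIV» merge): Kolyvagin's bound on
# `#(S_{p^{2M₀}}(E/K)/ℤδx₀)` REFINED to `p^{2(M₀−t)}` when every Kolyvagin class is killed by `p^{2M₀−t}`
# (crux `EulerHalvesAtThree`, item stmt-BirchSwinnertonDyer-19109, along the road to DERIVE the r3 stub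
# `stub_inertSavingDisplayAtThree`; cell `bsd-stepL`, seat `bsd-stepL-tam3-p1` g11, owner of the line;
# `--supports stmt-BirchSwinnertonDyer-19109 --as helper`)

HONEST FRAMING: ONE THEOREM (no definition, no named fact, no `sorry`); nothing here is a BSD class theorem; no census
label moves (T7); item 19109 is NOT closed; the statement is CONDITIONAL on its displayed binders exactly as its two
parents. BSD is not proved by any of this.

## Why (the «SHIFT×DIV» merge)

19109's r3 candidate (tam3-p1 g11, `HOME/tam3-p1/skeleton-19109-g11/inert-r3.lean`) trades the IMC-grade residual for ONE
classical-grade OPEN display: the inert display of `X_{N⁺,N⁻}` with its order clause SHARPENED by Jetchev's saving,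
`ord₃ #Ш(E/K)[3^∞] + 2s ≤ 2·ord₃[E(K):ℤP]`. On the `X₀(N)` side the same sharpening is KERNEL: tam3-p1 g9 refined x11b3-p2's
Kolyvagin ORDER chain by a global-divisibility exponent `t` (`Literature/…/HeegnerPointsKolyvaginPrimary{OrderTelescope,Order,
OrderBound,ShaBound}DivisibleProofs.lean`, `Theorems/ClassRecordThreeKolyvaginShaOrder{AtPrime,OfPoints}Divisible.lean`; the
delta per file is «add `(t, ht, hdivt)`, sharpen the bound, call the `_of_pow_smul_c_eq_zero` structure theorem»). The
INERT Shimura display of 19109 (r2, derived) runs on corner3-p2 g5's IMAGE-KEYED chain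
`Theorems/ClassRecordThreeCornerAtThreeKolyImage*Shift*.lean` (the depth-`(M+k)` SHIFTED twin of x11b3's chain). The two
modifications are orthogonal (the shift touches the Čebotarev ∕ dictionary leaves, the divisibility touches McCallum's §5
structure step), so the SAVED display is reached by applying g9's delta file by file to the image-keyed shifted chain:
D1 (this file) OrderBound, D2 OrderSha, D3 OrderAtPrime, D4 Entry ∕ End, D5 the index-form END, D6 the display from
primitives — leaving as the ONE open input the class-form global divisibility of the Shimura-curve Kolyvagin system at
the places outside `S` (Jetchev 2008 Thm. 1.1 read on `X_{N⁺,N⁻}`; on `X₀(N)` it is bsd-jet's kernel walk).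

## THIS FILE
`card_quotient_selmer_le_of_localTerm_shift_ofImage_of_pow_smul_cl_eq_zero` — corner3-p2's
`card_quotient_selmer_le_of_localTerm_shift_ofImage` (p570636-series, file `…KolyImageOrderBoundShift.lean`) VERBATIM with the
added binders `(t) (ht : t ≤ 2M₀) (hdivt)` and the bound `p^{2(M₀−t)}`, the abstract step being g9's
`HypothesesM.card_quotient_le_of_casselsTate_of_pow_smul_c_eq_zero`; the depth-`(2M₀+k)` dictionary, `hCTV` and Čebotarev
leaves are IMPORTED from the parent (not copied).
[cite: McCallumLMS1991, §1 Theorem (Kolyvagin), §5 Lemmas 5.1, 5.3, Thm. 5.4, Cor. 5.6] [cite: Jetchev2008, p. 812 (1), Cor. 1.5]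
[cite: GrossLMS1991, §2 Thm. 2.2 (2)] [cite: MilneADT2006, Ch. I §6 Prop. 6.9, Thm. 6.13(a), Lemma 6.17]
presearch: as the parents (nothing in print at an inert p = 3; the merge is bookkeeping).
-/

noncomputable section

open scoped Classical AddSubgroup
set_option linter.dupNamespace false

universe u

namespace Summit.BirchSwinnertonDyer.BirchSwinnertonDyer.Theorems.ShimuraKolyvaginOfImage

open Summit.BirchSwinnertonDyer.BirchSwinnertonDyer.Theorems.ShimuraKolyvaginOrder
open CategoryTheory _root_.WeierstrassCurve Field Function NumberField IsDedekindDomain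
open Literature.NumberTheory.EllipticCurves Literature.NumberTheory.EllipticCurves.KolyvaginDescent
open Literature.NumberTheory.GaloisRepresentations Literature.NumberTheory.GaloisCohomology
open Literature.NumberTheory.GaloisRepresentations.DiscreteGaloisModule (mu MuCarrier pairing)
open Literature.GroupTheory.FiniteAbelian
open Summit.BirchSwinnertonDyer.BirchSwinnertonDyer.Theorems
open scoped ContRepresentation


variable (W : WeierstrassCurve ℚ) {K : Type} [Field K] [NumberField K]

/-- **Kolyvagin's bound on `#Ш(E/K)_{p^M}` REFINED BY GLOBAL DIVISIBILITY (McCallum 1991 Cor. 5.6 with `m ≥ t`; Jetchev 2008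
(1)), at level `M = 2M₀`, assembled, conductor-keyed, depth `2M₀ + k`, image-keyed** — corner3-p2 g5's
`card_quotient_selmer_le_of_localTerm_shift_ofImage` VERBATIM (same binders, same proof through the same dictionary ∕ hCTV ∕
Čebotarev leaves of the image-keyed chain) with ONE added hypothesis — every Kolyvagin class `cl m` (square-free `m` on
depth-`(2M₀ + k)` Kolyvagin primes) is killed by `p^{2M₀ − t}` — and the conclusion sharpened to
`#(S_{p^{2M₀}}(E/K) / ℤ δ x₀) ≤ p^{2(M₀ − t)}`; the last step calls tam3-p1 g9's abstract refined structure theorem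
`HypothesesM.card_quotient_le_of_casselsTate_of_pow_smul_c_eq_zero` instead of `…card_quotient_le_of_casselsTate`
(exactly g9's delta `card_quotient_selmer_le_of_localTerm` ↦ `…_of_pow_smul_cl_eq_zero` on the `X₀(N)` chain).
[cite: McCallumLMS1991, §1 Theorem; Thm. 5.4, Cor. 5.6] [cite: Jetchev2008, p. 812 (1) and Cor. 1.5]
[cite: MilneADT2006, Ch. I §6, Prop. 6.9, Thm. 6.13(a)] -/
theorem card_quotient_selmer_le_of_localTerm_shift_ofImage_of_pow_smul_cl_eq_zero [W.IsElliptic] (hK : IsImaginaryQuadratic K)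
    {N₀ : ℕ} [NeZero N₀] (hN : W.conductorNorm ℤ = N₀) (k : ℕ) {Pt : (W.baseChange K).toAffine.Point}
    {p : ℕ} (hp : p.Prime) (hp2 : p ≠ 2) (hIz : ∃ z : Field.absoluteGaloisGroup K, ∀ t : geomTorsion (W.baseChange K) p, z • t = -t)
    (hIs : (W.baseChange K).HasIrreducibleModPGaloisRep p)
    (hIc : ∀ f : geomTorsion (W.baseChange K) p →+ geomTorsion (W.baseChange K) p,
      (∀ (g : Field.absoluteGaloisGroup K) (t : geomTorsion (W.baseChange K) p), f (g • t) = g • f t) →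
        ∃ k : ℤ, ∀ t, f t = k • t)
    (hIt : AddSubgroup.torsionBy (W.baseChange K).toAffine.Point (p : ℤ) = ⊥)
    (hC : Literature.NumberTheory.Automorphic.chebotarev_artinRep) (hW : W.exists_weilPairing p)
    {M₀ : ℕ} (hM₀ : 1 ≤ M₀) [NeZero (p ^ M₀)]
    (hdiv : ∀ Q : geomPoints (W.baseChange K), ∃ R, ((p ^ M₀ * p ^ M₀ : ℕ) : ℤ) • R = Q)
    {c : K ≃ₐ[ℚ] K} (hc : c ≠ 1) (hcc : c * c = 1)
    {x₀ : (W.baseChange K).toAffine.Point} (hx₀ : p ^ M₀ • x₀ = Pt)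
    (hPx : kummerMapTorsion (W.baseChange K) _ hdiv Pt =
      ((p : ℤ) ^ M₀) • kummerMapTorsion (W.baseChange K) _ hdiv x₀)
    (hxord : ((p : ℤ) ^ (2 * M₀ - 1)) • kummerMapTorsion (W.baseChange K) _ hdiv x₀ ≠ 0)
    (ε : ℤ) (hε : ε = 1 ∨ ε = -1)
    (h53 : IsOfFinAddOrder (Affine.Point.map (W' := W) (c : K →ₐ[ℚ] K) Pt - ε • Pt))
    (cl : ℕ → galH1Torsion (W.baseChange K) ((p ^ M₀ * p ^ M₀ : ℕ) : ℤ))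
    (hc1 : cl 1 = kummerMapTorsion (W.baseChange K) _ hdiv Pt)
    (hcl : ∀ m : ℕ, Squarefree m →
      (∀ q ∈ m.primeFactors, IsKolyvaginPrime N₀ W K p q ∧ FrobEqFrobInfty W K (p ^ (2 * M₀ + k)) q) →
      conjAct W c _ (cl m) = (ε * (-1) ^ m.primeFactors.card) • cl m ∧
      (∀ v : HeightOneSpectrum (𝓞 K), (m : 𝓞 K) ∉ v.asIdeal →
        cl m ∈ selmerLocalKer (W.baseChange K) (v.adicCompletion K) ((p ^ M₀ * p ^ M₀ : ℕ) : ℤ)) ∧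
      (∀ ℓ : ℕ, ℓ.Prime → ℓ ∣ m → ∀ v : HeightOneSpectrum (𝓞 K), (ℓ : 𝓞 K) ∈ v.asIdeal →
        ∀ a : ℕ, (((p : ℤ) ^ a) • cl m ∈
            selmerLocalKer (W.baseChange K) (v.adicCompletion K) ((p ^ M₀ * p ^ M₀ : ℕ) : ℤ) ↔
          ((p : ℤ) ^ a) • cl (m / ℓ) ∈
            (W.baseChange K).torsionLocalKer (v.adicCompletion K) ((p ^ M₀ * p ^ M₀ : ℕ) : ℤ))))
    (hdual : ∀ ℓ : ℕ, IsKolyvaginPrime N₀ W K p ℓ ∧ FrobEqFrobInfty W K (p ^ (2 * M₀ + k)) ℓ →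
      ∀ ν : ℤ, (ν = 1 ∨ ν = -1) → ∀ d : galH1Torsion (W.baseChange K) ((p ^ M₀ * p ^ M₀ : ℕ) : ℤ),
      conjAct W c _ d = ν • d →
      (∀ v : HeightOneSpectrum (𝓞 K), (ℓ : 𝓞 K) ∉ v.asIdeal →
        d ∈ selmerLocalKer (W.baseChange K) (v.adicCompletion K) ((p ^ M₀ * p ^ M₀ : ℕ) : ℤ)) →
      (∀ w : InfinitePlace K,
        d ∈ selmerLocalKer (W.baseChange K) w.Completion ((p ^ M₀ * p ^ M₀ : ℕ) : ℤ)) →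
      ∀ s ∈ selmerGroup (W.baseChange K) ((p ^ M₀ * p ^ M₀ : ℕ) : ℤ), conjAct W c _ s = ν • s →
      ∀ a : ℕ, a < 2 * M₀ → ∀ v : HeightOneSpectrum (𝓞 K), (ℓ : 𝓞 K) ∈ v.asIdeal →
        ((p : ℤ) ^ a) • d ∉
          selmerLocalKer (W.baseChange K) (v.adicCompletion K) ((p ^ M₀ * p ^ M₀ : ℕ) : ℤ) →
        ((p : ℤ) ^ (2 * M₀ - 1 - a)) • s ∈
          (W.baseChange K).torsionLocalKer (v.adicCompletion K) ((p ^ M₀ * p ^ M₀ : ℕ) : ℤ))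
    -- the Cassels–Tate inputs at level `m = p^{M₀}`, auxiliary level `m² = p^M`
    (e : geomTorsion (W.baseChange K) ((p ^ M₀ * p ^ M₀ : ℕ) : ℤ) →
      geomTorsion (W.baseChange K) ((p ^ M₀ * p ^ M₀ : ℕ) : ℤ) → AlgebraicClosure K)
    (hμ : ∀ S T, e S T ^ (p ^ M₀ * p ^ M₀) = 1)
    (hadd₁ : ∀ S₁ S₂ T, e (S₁ + S₂) T = e S₁ T * e S₂ T)
    (hadd₂ : ∀ S T₁ T₂, e S (T₁ + T₂) = e S T₁ * e S T₂)
    (hgal : ∀ (σ : absoluteGaloisGroup K) (S T : geomTorsion (W.baseChange K) ((p ^ M₀ * p ^ M₀ : ℕ) : ℤ)),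
      σ • e S T = e (σ • S) (σ • T))
    (halt : ∀ T, e T T = 1)
    (inv : LocalInvariants K (p ^ M₀ * p ^ M₀)) (hPT' : inv.SumInvLocalizationEqZero)
    (hH3 : ∀ x : galoisCohomology (mu K (p ^ M₀ * p ^ M₀)) 3,
      (∀ v : Place K, galoisCohomology.localization (mu K (p ^ M₀ * p ^ M₀)) v 3 x = 0) → x = 0)
    (hB : IsLevelPairing (p ^ M₀)
      (ctLevelPairing (W.baseChange K) (p ^ M₀) e hμ hadd₁ hadd₂ hgal inv halt hPT' hH3
        (localTerm_finite_support (W := W.baseChange K) (m := p ^ M₀) (e := e) (hμ := hμ)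
          (hadd₁ := hadd₁) (hadd₂ := hadd₂) (hgal := hgal) halt inv)))
    (hPτ : ∀ z ∈ selmerGroup (W.baseChange K) ((p ^ M₀ * p ^ M₀ : ℕ) : ℤ),
      ∀ t ∈ selmerGroup (W.baseChange K) ((p ^ M₀ * p ^ M₀ : ℕ) : ℤ),
      ctGeneralFun (W.baseChange K) (p ^ M₀) e hμ hadd₁ hadd₂ hgal inv
          (torsionH1ToH1 (W.baseChange K) _ (conjAct W c _ z))
          (torsionH1ToH1 (W.baseChange K) _ (conjAct W c _ t)) =
        ctGeneralFun (W.baseChange K) (p ^ M₀) e hμ hadd₁ hadd₂ hgal inv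
          (torsionH1ToH1 (W.baseChange K) _ z) (torsionH1ToH1 (W.baseChange K) _ t))
    -- Kolyvagin's annihilation, in the two forms used
    (hkill : ∀ s ∈ selmerGroup (W.baseChange K) ((p ^ M₀ * p ^ M₀ : ℕ) : ℤ),
      ((p : ℤ) ^ M₀) • s ∈ AddSubgroup.zmultiples (kummerMapTorsion (W.baseChange K) _ hdiv x₀))
    (hL : ∀ a ∈ (W.baseChange K).sha, (((p ^ M₀ * p ^ M₀ : ℕ) : ℤ)) • a = 0 → ((p ^ M₀ : ℕ) : ℤ) • a = 0)
    -- McCallum's Lemma 5.3 for the Cassels–Tate local term at `λ`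
    (hloc : ∀ ℓ m : ℕ,
      (hℓ : IsKolyvaginPrime N₀ W K p ℓ ∧ FrobEqFrobInfty W K (p ^ (2 * M₀ + k)) ℓ) →
      KolSupp (fun q => IsKolyvaginPrime N₀ W K p q ∧ FrobEqFrobInfty W K (p ^ (2 * M₀ + k)) q) (ℓ * m) →
      ¬ ℓ ∣ m →
      ∀ (j N a b : ℕ) (t : galH1Torsion (W.baseChange K) ((p ^ M₀ * p ^ M₀ : ℕ) : ℤ)),
      t ∈ selmerGroup (W.baseChange K) ((p ^ M₀ * p ^ M₀ : ℕ) : ℤ) →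
      ((p : ℤ) ^ j) • cl (ℓ * m) ∈ selmerGroup (W.baseChange K) ((p ^ M₀ * p ^ M₀ : ℕ) : ℤ) →
      ((p : ℤ) ^ N) • t = 0 →
      conjAct W c ((p ^ M₀ * p ^ M₀ : ℕ) : ℤ) t = (ε * (-1) ^ (ℓ * m).primeFactors.card) • t →
      (∀ q ∈ m.primeFactors, ∀ v : HeightOneSpectrum (𝓞 K), (q : 𝓞 K) ∈ v.asIdeal →
        t ∈ (W.baseChange K).torsionLocalKer (v.adicCompletion K) ((p ^ M₀ * p ^ M₀ : ℕ) : ℤ)) →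
      M₀ ≤ j → N ≤ M₀ → N ≤ j → a + b + 1 = N →
      (¬ ∀ v : HeightOneSpectrum (𝓞 K), (ℓ : 𝓞 K) ∈ v.asIdeal →
        ((p : ℤ) ^ (a + (j - N))) • cl m ∈
          (W.baseChange K).torsionLocalKer (v.adicCompletion K) ((p ^ M₀ * p ^ M₀ : ℕ) : ℤ)) →
      (¬ ∀ v : HeightOneSpectrum (𝓞 K), (ℓ : 𝓞 K) ∈ v.asIdeal →
        ((p : ℤ) ^ b) • t ∈ (W.baseChange K).torsionLocalKer (v.adicCompletion K) ((p ^ M₀ * p ^ M₀ : ℕ) : ℤ)) →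
      ∀ D : FirstCaseData (W.baseChange K) (p ^ M₀), D.b₁ = ((p : ℤ) ^ (j - M₀)) • cl (ℓ * m) →
        galoisCohomology.map (inclKD (W.baseChange K) (p ^ M₀) (p ^ M₀)) 1 D.b' = t →
        D.localTerm e hμ hadd₁ hadd₂ hgal inv (Sum.inr hℓ.1.place) ≠ 0)
    -- GLOBAL DIVISIBILITY to depth `t`: every Kolyvagin class (depth-`(2M₀ + k)` primes) is killed by `p^{2M₀ − t}`
    (t : ℕ) (ht : t ≤ 2 * M₀)
    (hdivt : ∀ m : ℕ, Squarefree m →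
      (∀ q ∈ m.primeFactors, IsKolyvaginPrime N₀ W K p q ∧ FrobEqFrobInfty W K (p ^ (2 * M₀ + k)) q) →
      ((p : ℤ) ^ (2 * M₀ - t)) • cl m = 0) :
    Nat.card (selmerGroup (W.baseChange K) ((p ^ M₀ * p ^ M₀ : ℕ) : ℤ) ⧸
        (AddSubgroup.zmultiples (kummerMapTorsion (W.baseChange K) _ hdiv x₀)).addSubgroupOf
          (selmerGroup (W.baseChange K) ((p ^ M₀ * p ^ M₀ : ℕ) : ℤ))) ≤ p ^ (2 * (M₀ - t)) := by
  have hn : p ^ M₀ * p ^ M₀ = p ^ (2 * M₀) := by rw [two_mul, pow_add]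
  have hn0 : ((p ^ M₀ * p ^ M₀ : ℕ) : ℤ) ≠ 0 := by
    exact_mod_cast mul_ne_zero (NeZero.ne _) (NeZero.ne _)
  have hfin : ∀ D : GeneralCaseData (W.baseChange K) (p ^ M₀) e hμ hadd₁ hadd₂ hgal,
      ∃ S : Finset (Place K), ∀ v ∉ S, D.localTerm inv v = 0 :=
    localTerm_finite_support (W := W.baseChange K) (m := p ^ M₀) (e := e) (hμ := hμ)
      (hadd₁ := hadd₁) (hadd₂ := hadd₂) (hgal := hgal) halt inv
  -- the descent data with its dictionary
  obtain ⟨S, hSel, hx, hSp, hSM₀, hSM, hSτ, hSKol, hSA, hSc, hSε⟩ :=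
    exists_hypothesesM_of_leavesM_dictionary_level_shift_ofImage W (N := N₀) hK hp hp2 hIz hIs hIc hIt hC hW (M := 2 * M₀)
      (by omega) k (n := p ^ M₀ * p ^ M₀) hn hdiv hc hcc hx₀ hPx hxord ε hε h53 cl hc1 hcl hdual
  haveI : Finite S.Sel := by
    rw [hSel]
    exact (W.baseChange K).finite_selmerGroup_holds hn0
  -- the Cassels–Tate pairing pulled back to `Sel`
  obtain ⟨ι, hι⟩ := exists_selmerToShaTorsion (W.baseChange K) (p ^ M₀) hL
  let incl : S.Sel →+ selmerGroup (W.baseChange K) ((p ^ M₀ * p ^ M₀ : ℕ) : ℤ) :=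
    AddSubgroup.inclusion hSel.le
  let P : S.Sel →+ S.Sel →+ AddCircle (1 : ℚ) :=
    ((ctLevelPairing (W.baseChange K) (p ^ M₀) e hμ hadd₁ hadd₂ hgal inv halt hPT' hH3 hfin).comp
      (ι.comp incl)).compl₂ (ι.comp incl)
  have hPapp : ∀ z t : S.Sel, P z t =
      ctLevelPairing (W.baseChange K) (p ^ M₀) e hμ hadd₁ hadd₂ hgal inv halt hPT' hH3 hfin
        (ι (incl z)) (ι (incl t)) := fun _ _ => rfl
  have hincl : ∀ (v : galH1Torsion (W.baseChange K) ((p ^ M₀ * p ^ M₀ : ℕ) : ℤ)) (hv : v ∈ S.Sel),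
      incl ⟨v, hv⟩ = ⟨v, hSel ▸ hv⟩ := fun _ _ => rfl
  -- `P` alternating
  have halt' : ∀ z, P z z = 0 := fun z => by rw [hPapp]; exact hB.1 _
  -- `P` is `τ`-invariant
  have hPτ' : ∀ z t : S.Sel, P ⟨S.τ z, S.τ_mem z z.2⟩ ⟨S.τ t, S.τ_mem t t.2⟩ = P z t := by
    intro z t
    rw [hPapp, hPapp]
    have key := hPτ _ (hSel.le z.2) _ (hSel.le t.2)
    rw [ctLevelPairing_pullback_apply e hμ hadd₁ hadd₂ hgal inv halt hPT' hH3 hfin ι hι,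
      ctLevelPairing_pullback_apply e hμ hadd₁ hadd₂ hgal inv halt hPT' hH3 hfin ι hι]
    change zmodToCircle _ (ctGeneralFun (W.baseChange K) (p ^ M₀) e hμ hadd₁ hadd₂ hgal inv
        (torsionH1ToH1 (W.baseChange K) ((p ^ M₀ * p ^ M₀ : ℕ) : ℤ)
          (S.τ (z : galH1Torsion (W.baseChange K) ((p ^ M₀ * p ^ M₀ : ℕ) : ℤ))))
        (torsionH1ToH1 (W.baseChange K) ((p ^ M₀ * p ^ M₀ : ℕ) : ℤ)
          (S.τ (t : galH1Torsion (W.baseChange K) ((p ^ M₀ * p ^ M₀ : ℕ) : ℤ))))) =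
      zmodToCircle _ (ctGeneralFun (W.baseChange K) (p ^ M₀) e hμ hadd₁ hadd₂ hgal inv
        (torsionH1ToH1 (W.baseChange K) ((p ^ M₀ * p ^ M₀ : ℕ) : ℤ)
          (z : galH1Torsion (W.baseChange K) ((p ^ M₀ * p ^ M₀ : ℕ) : ℤ)))
        (torsionH1ToH1 (W.baseChange K) ((p ^ M₀ * p ^ M₀ : ℕ) : ℤ)
          (t : galH1Torsion (W.baseChange K) ((p ^ M₀ * p ^ M₀ : ℕ) : ℤ))))
    rw [hSτ, hSτ, key]
  -- `P(x, ·) = 0`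
  have hPx' : ∀ t, P ⟨S.x, S.x_mem⟩ t = 0 := fun t => by
    rw [hPapp]
    refine pullback_eq_zero_of_torsionH1ToH1_eq_zero _ ι hι ?_ _
    change torsionH1ToH1 (W.baseChange K) _ S.x = 0
    rw [hx]
    exact torsionH1ToH1_kummerMapTorsion (W.baseChange K) _ hdiv x₀
  -- `hkill` for `S`
  have hkill' : ∀ t ∈ S.Sel, ((S.p : ℤ) ^ M₀) • t ∈ AddSubgroup.zmultiples S.x := by
    intro t ht
    rw [hSp, hx]
    rw [hSel] at ht
    exact hkill t ht
  -- non-degeneracy modulo `ℤx`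
  have hnd' : ∀ z : S.Sel, (∀ t, P z t = 0) → (z : galH1Torsion (W.baseChange K) _) ∈
      AddSubgroup.zmultiples S.x := by
    intro z hz
    have hall : ∀ t : selmerGroup (W.baseChange K) ((p ^ M₀ * p ^ M₀ : ℕ) : ℤ),
        ctLevelPairing (W.baseChange K) (p ^ M₀) e hμ hadd₁ hadd₂ hgal inv halt hPT' hH3 hfin
          (ι (incl z)) (ι t) = 0 := fun t => by
      have h := hz ⟨t, hSel.ge t.2⟩
      rw [hPapp] at h
      exact h
    have h0 := torsionH1ToH1_eq_zero_of_forall_pullback_eq_zero _ ι hι hB hL hall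
    rw [hx]
    exact mem_zmultiples_of_torsionH1ToH1_eq_zero_level_of_torsionBy_eq_bot W hp hIt (M := 2 * M₀) hn le_rfl
      hdiv x₀ hxord hkill h0
  -- `hCTV` from the local term at `λ`
  have hcl2 : ∀ n : ℕ, Squarefree n →
      (∀ q ∈ n.primeFactors, IsKolyvaginPrime N₀ W K p q ∧ FrobEqFrobInfty W K (p ^ (2 * M₀ + k)) q) →
      ∀ v : HeightOneSpectrum (𝓞 K), (n : 𝓞 K) ∉ v.asIdeal →
        cl n ∈ selmerLocalKer (W.baseChange K) (v.adicCompletion K) ((p ^ M₀ * p ^ M₀ : ℕ) : ℤ) :=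
    fun n hn hq => (hcl n hn hq).2.1
  have hCTV' := hCTV_of_localTerm_shift_ofImage W e hμ hadd₁ hadd₂ hgal inv halt hPT' hH3 hfin ι hι hK hN k
    hp hp2 hIz hIs hIc hIt c ε cl hcl2 S hSel hSp hSM₀ hSM hSτ hSKol hSA hSc hSε hloc
  -- `hCeb` from the Čebotarev density theorem
  have hCeb' : ∀ (T : Finset (galH1Torsion (W.baseChange K) ((p ^ M₀ * p ^ M₀ : ℕ) : ℤ)))
      (g₁ g₂ : galH1Torsion (W.baseChange K) ((p ^ M₀ * p ^ M₀ : ℕ) : ℤ)) (ν : ℤ), (ν = 1 ∨ ν = -1) →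
      S.τ g₁ = ν • g₁ → S.τ g₂ = (-ν) • g₂ → (∀ t ∈ T, ∃ e : ℤ, (e = 1 ∨ e = -1) ∧ S.τ t = e • t) →
      ∀ b : ℕ, ∃ ℓ, b < ℓ ∧ S.Kol ℓ ∧
        ∀ g ∈ AddSubgroup.closure (insert g₁ (insert g₂ (T : Set _))),
          g ∈ S.A ℓ ↔ g ∈ AddSubgroup.closure (T : Set _) :=
    fun T g₁ g₂ ν hν hg₁ hg₂ hT b =>
      ceb_kernel_of_dictionary_level_shift_ofImage W (N := N₀) hn k S hC hK hp hp2 hIz hIs hIc hIt hW (by omega) hc hcc hSτ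
        (fun ℓ h₁ h₂ => (hSKol ℓ).mpr ⟨h₁, h₂⟩) (fun ℓ _ g => hSA ℓ g) T g₁ g₂ ν hν hg₁ hg₂ hT b
  -- the divisibility in `S`'s currency
  have hdivS : ∀ n : ℕ, KolSupp S.Kol n → ((S.p : ℤ) ^ (S.M - t)) • S.c n = 0 := by
    intro n hn
    rw [hSp, hSM, hSc]
    exact hdivt n hn.1 fun q hq ↦ (hSKol q).mp (hn.2 q hq)
  -- the abstract REFINED bound (McCallum Cor. 5.6 under global divisibility; tam3-p1 g9's structure theorem)
  have key := S.card_quotient_le_of_casselsTate_of_pow_smul_c_eq_zero P halt' hPτ' hPx' hnd' hCTV' hCeb' hkill'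
    (by rw [hSM₀, hSM]; omega) t (by rw [hSM]; exact ht) hdivS
  rw [hSp, hSM₀] at key
  rw [hSel, hx] at key
  exact key

end Summit.BirchSwinnertonDyer.BirchSwinnertonDyer.Theorems.ShimuraKolyvaginOfImage

end
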